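import Summits.MatrixMultiplication.MatrixMultiplication.Theses.ThinBlockAlpha
import Literature.Barriers.MatrixMultiplication.TricoloredSumFreeBarrier
import Literature.Combinatorics.Additive.TricoloredSumFreeBound

/-!
# Disproof work file — crux `BoundedExponentThird` (stmt-MatrixMultiplication-10596, route ThinBlockAlpha)

Standing adversary file (cdisprove seat).  Prose lives in docstrings; every `theorem` below is
kernel-checked unless it is in the `NearMisses` section (sorries allowed only there).
LANDED (import these instead of copying): `Theorems/BoundedExponentThird/Negative/TwoLegBound.lean`
(§1–§3, p74769), `…/Negative/CoherentFamilies.lean` (§3b–§3c, p75833), `…/Negative/BlocksGrow.lean`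
(§4, p76302) — namespace `Summit.MatrixMultiplication.MatrixMultiplication.Theorems.BoundedExponentThird.Negative`.

## Findings (index)

* §1 `translate_not_mem`, `card_union_ge` — THE TWO-LEG TRANSLATION MECHANISM: for an STPP family
  the leg sets `U i = C i − A i` are disjoint of full size, and every translate `U i + d`,
  `d ∈ (B i − B i) ∖ {0}`, avoids ALL `U j`.  Consequence (`two_leg_bound`):
  `(L + M − 1) · N² ≤ |H|` for blocks `⟨N, M, N⟩` — exact two-leg tightness `|H| = L N²` forces
  `M ≤ 1`.
* §2 `not_BoundedExponentThirdExact` — the η = 0 endpoint of the crux is FALSE (natural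
  strengthening refuted); `blocks_forced` — any witness at slack `η` has `L (N^η − 1) ≥ M − 1`.
* §3 `not_BoundedExponentThirdTranslateB` — designs whose middle sets `B i` are translates of ONE
  set `B₀` (product / coset designs with a common middle pattern, in particular `L = 1`) satisfy
  `|H| ≥ L N² M` and certify nothing: that strengthening is FALSE.  Any witness needs
  "incoherent" middle sets.
* §3b `sum_card_mul_le_of_coset_legs`, `not_BoundedExponentThirdCosetLegs` — dually, leg sets
  `C i − A i` that are cosets of ONE subgroup `V` (linear designs with a common leg space) give
  `L N² M ≤ |H|`: that strengthening is FALSE too.  Witnesses need incoherent leg stabilisers.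
* §3c `card_mul_le_of_translate_first/third`, `not_BoundedExponentThirdTranslateA` — ONE
  translate-coherent outer family (`A i = A₀ + x i`, or `C i = C₀ + z i`) already forces the full
  volume bound `L·N·M·N ≤ |H|`.  Net: in a witness NONE of the three families is a family of
  translates of a single set.
* §4 `not_BoundedExponentThirdBoundedN` — in bounded exponent the blocks must GROW: for every
  `ℓ, N₀` there is `η₀ > 0` below which no design with `N ≤ N₀` exists (tree Thm A
  `exists_tricoloredSumFree_card_le` + §1).  So finite searches can calibrate but never witness.
* §5 Why the crux resists (docstring `resists`): every degeneration-monotone invariant sees only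
  `L·N·M`; the kill needs a two-leg invariant that USES `M ≥ N^{1/3}`; regimes left open.

SEE ALSO (sibling seats, landed; complementary, not duplicated here):
`Theorems/ThinPackings/Negative/ThinPackingsPacking.lean` — `packing_three`:
`L N² + L M N − N ≤ |H|` (two legs + one short leg; stronger than `two_leg_bound` iff `L M > (M−1)N`,
and it refutes bounded `N` in ALL abelian groups without Thm A);
`…/ThinPackingsDifferenceCores.lean` — `(Σ|Bᵢ||Cᵢ|)·|P| ≤ |H|` for any difference core
`P − P ⊆ ⋂(Aᵢ − Aᵢ)` and rotations (generalises §3/§3c: no leg of a witness is a family of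
translates, cores of size `≤ N^η` only); `…/ThinPackingsReduction.lean` — `ThinPackings ↔ CThesis`
(the unbounded-exponent sibling is the abelian-STPP `ω = 2` thesis in costume; for THIS crux the fat
end `a > a₀(ℓ)` is instead killed by Thm B, so witnesses live in `a ∈ [1/3, a₀(ℓ)]`);
`Theorems/RectangularThmB/Negative/TwoLegTranslate.lean` — `succ_mul_sq_le_card` (`(L+1)N² ≤ |H|`,
the `M = 2` case of `two_leg_bound`) and `no_finite_witness`; the twin's
`Cruxes/RectangularThmB/Disproof.lean` `resists` table (skew local strong USP searches: best two-leg
exponent found at `a = 1/3`, `q = 7` is `η = 0.218`, i.e. `κ = 0.65`, width 14).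
-/

namespace Summit.MatrixMultiplication.MatrixMultiplication.Cruxes.BoundedExponentThird.Disproof

open Finset Literature.Computability.AlgebraicComplexity
open Summit.MatrixMultiplication.MatrixMultiplication.Theses.ThinBlockAlpha (BoundedExponentThird)

section Mechanism

variable {H : Type*} [AddCommGroup H] {L : ℕ} {A B C : Fin L → Finset H}

/-- **Translation mechanism.** In an STPP family, for `a ∈ A i`, `c ∈ C i` and two DISTINCT
middle elements `b ≠ b'` of the same block, the translate `(c − a) + (b' − b)` is never of the form
`c' − a'` with `a' ∈ A j`, `c' ∈ C j` — for ANY block `j`, including `j = i`.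
(STPP instance `(i, i, j)` of the tree's one-clause `IsSTPP`.) -/
theorem translate_not_mem (h : IsSTPP A B C) {i j : Fin L} {a c b b' a' c' : H}
    (ha : a ∈ A i) (hc : c ∈ C i) (hb : b ∈ B i) (hb' : b' ∈ B i) (hbb' : b ≠ b')
    (ha' : a' ∈ A j) (hc' : c' ∈ C j) : (c - a) + (b' - b) ≠ c' - a' := by
  intro he
  have e1 : (c - a) + (b' - b) - (c' - a') = 0 := sub_eq_zero.mpr he
  have e2 : (a - a') + (b - b') + (c' - c) = -((c - a) + (b' - b) - (c' - a')) := by abel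
  have key := h i i j a' ha' a ha b' hb' b hb c hc c' hc' (by rw [e2, e1, neg_zero])
  exact hbb' key.2.2.2.1.symm

/-- `(a, c) ↦ c − a` is injective on a block (the TPP part; needs `B i` nonempty). -/
theorem sub_injOn (h : IsSTPP A B C) {i : Fin L} (hB : (B i).Nonempty) :
    Set.InjOn (fun p : H × H => p.2 - p.1) ↑((A i) ×ˢ (C i)) := by
  rintro ⟨a, c⟩ hp ⟨a', c'⟩ hp' (he : c - a = c' - a')
  simp only [coe_product, Set.mem_prod, mem_coe] at hp hp'
  obtain ⟨b, hb⟩ := hB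
  have e2 : (a' - a) + (b - b) + (c - c') = (c - a) - (c' - a') := by abel
  have key := h i i i a hp.1 a' hp'.1 b hb b hb c' hp'.2 c hp.2 (by rw [e2, he, sub_self])
  exact Prod.ext key.2.2.1 key.2.2.2.2.symm

variable [DecidableEq H]

/-- The leg set `U i = C i − A i` of block `i`. -/
def legSet (A C : Fin L → Finset H) (i : Fin L) : Finset H :=
  ((A i) ×ˢ (C i)).image fun p => p.2 - p.1

/-- The two-leg packed set `W = ⋃ᵢ (C i − A i)`. -/
def packedSet (A C : Fin L → Finset H) : Finset H := Finset.univ.biUnion (legSet A C)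

theorem mem_legSet {A C : Fin L → Finset H} {i : Fin L} {x : H} :
    x ∈ legSet A C i ↔ ∃ a ∈ A i, ∃ c ∈ C i, c - a = x := by
  simp only [legSet, mem_image, mem_product, Prod.exists]
  constructor
  · rintro ⟨a, c, ⟨ha, hc⟩, rfl⟩; exact ⟨a, ha, c, hc, rfl⟩
  · rintro ⟨a, ha, c, hc, rfl⟩; exact ⟨a, c, ⟨ha, hc⟩, rfl⟩

theorem card_legSet (h : IsSTPP A B C) {i : Fin L} (hB : (B i).Nonempty) :
    (legSet A C i).card = (A i).card * (C i).card := by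
  rw [legSet, card_image_of_injOn (sub_injOn h hB), card_product]

theorem disjoint_legSet (h : IsSTPP A B C) (hB : ∀ i, (B i).Nonempty) {i j : Fin L} (hij : i ≠ j) :
    Disjoint (legSet A C i) (legSet A C j) := by
  rw [Finset.disjoint_left]
  intro x hx hx'
  obtain ⟨a, ha, c, hc, rfl⟩ := mem_legSet.1 hx
  obtain ⟨a', ha', c', hc', he⟩ := mem_legSet.1 hx'
  obtain ⟨b, hb⟩ := hB j
  have e2 : (a' - a) + (b - b) + (c - c') = (c - a) - (c' - a') := by abel
  have key := h j j i a ha a' ha' b hb b hb c' hc' c hc (by rw [e2, he, sub_self])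
  exact hij key.2.1.symm

theorem card_packedSet (h : IsSTPP A B C) (hB : ∀ i, (B i).Nonempty) :
    (packedSet A C).card = ∑ i, (A i).card * (C i).card := by
  rw [packedSet, card_biUnion (fun i _ j _ hij => disjoint_legSet h hB hij)]
  exact Finset.sum_congr rfl fun i _ => card_legSet h (hB i)

/-- The translates of block `i₀` by the nonzero differences `b − b₀`, `b ∈ B i₀ ∖ {b₀}`. -/
def translateSet (A B C : Fin L → Finset H) (i₀ : Fin L) (b₀ : H) : Finset H :=
  (((B i₀).erase b₀) ×ˢ ((A i₀) ×ˢ (C i₀))).image fun q => (q.2.2 - q.2.1) + (q.1 - b₀)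

theorem card_translateSet (h : IsSTPP A B C) {i₀ : Fin L} {b₀ : H} (hb₀ : b₀ ∈ B i₀) :
    (translateSet A B C i₀ b₀).card = ((B i₀).card - 1) * ((A i₀).card * (C i₀).card) := by
  rw [translateSet, card_image_of_injOn, card_product, card_product, card_erase_of_mem hb₀]
  rintro ⟨b, a, c⟩ hq ⟨b', a', c'⟩ hq' (he : (c - a) + (b - b₀) = (c' - a') + (b' - b₀))
  simp only [coe_product, Set.mem_prod, mem_coe, mem_erase] at hq hq'
  have e2 : (a' - a) + (b - b') + (c - c') = ((c - a) + (b - b₀)) - ((c' - a') + (b' - b₀)) := by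
    abel
  have key := h i₀ i₀ i₀ a hq.2.1 a' hq'.2.1 b' hq'.1.2 b hq.1.2 c' hq'.2.2 c hq.2.2
    (by rw [e2, he, sub_self])
  obtain ⟨-, -, h1, h2, h3⟩ := key
  exact Prod.ext h2.symm (Prod.ext h1 h3.symm)

theorem disjoint_packedSet_translateSet (h : IsSTPP A B C) {i₀ : Fin L} {b₀ : H} (hb₀ : b₀ ∈ B i₀) :
    Disjoint (packedSet A C) (translateSet A B C i₀ b₀) := by
  rw [Finset.disjoint_right]
  intro x hx hx'
  simp only [translateSet, mem_image, mem_product, mem_erase, Prod.exists] at hx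
  obtain ⟨b, a, c, ⟨⟨hbb, hb⟩, ha, hc⟩, rfl⟩ := hx
  simp only [packedSet, mem_biUnion, mem_univ, true_and] at hx'
  obtain ⟨j, hj⟩ := hx'
  obtain ⟨a', ha', c', hc', he⟩ := mem_legSet.1 hj
  exact translate_not_mem h ha hc hb₀ hb (Ne.symm hbb) ha' hc' he.symm

/-- **Two-leg bound with the middle-leg correction.** For an STPP family in a finite abelian group,
any block `i₀` and any `b₀ ∈ B i₀`:
`∑ᵢ |A i||C i| + (|B i₀| − 1)·|A i₀||C i₀| ≤ |H|`. -/
theorem card_union_ge [Fintype H] (h : IsSTPP A B C) (hB : ∀ i, (B i).Nonempty) {i₀ : Fin L} {b₀ : H}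
    (hb₀ : b₀ ∈ B i₀) :
    ∑ i, (A i).card * (C i).card + ((B i₀).card - 1) * ((A i₀).card * (C i₀).card) ≤
      Fintype.card H := by
  rw [← card_packedSet h hB, ← card_translateSet h hb₀,
    ← card_union_of_disjoint (disjoint_packedSet_translateSet h hb₀)]
  exact card_le_univ _

/-- **Two-leg bound, uniform blocks `⟨N, M, N⟩`:** `(L + (M − 1)) · N² ≤ |H|` as soon as `M ≥ 1`
and the family is nonempty.  Exact two-leg tightness `|H| = L·N²` therefore forces `M ≤ 1`:
the `a = 0` coset tilings are the ONLY exactly tight designs. -/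
theorem two_leg_bound [Fintype H] (h : IsSTPP A B C) {N M : ℕ} (hA : ∀ i, (A i).card = N)
    (hBc : ∀ i, (B i).card = M) (hC : ∀ i, (C i).card = N) (hM : 1 ≤ M) (i₀ : Fin L) :
    (L + (M - 1)) * (N * N) ≤ Fintype.card H := by
  have hB : ∀ i, (B i).Nonempty := fun i => card_pos.1 (by rw [hBc i]; exact hM)
  obtain ⟨b₀, hb₀⟩ := hB i₀
  have := card_union_ge h hB hb₀
  simp only [hA, hC, hBc, sum_const, card_univ, Fintype.card_fin, smul_eq_mul] at this
  linarith [this, Nat.add_mul L (M - 1) (N * N)]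

end Mechanism

/-! ## §2  The crux, one slack level at a time; the `η = 0` endpoint is false -/

section SlackLevels

/-- One slack level of the crux: an exponent-`≤ ℓ` abelian design of blocks `⟨N, M, N⟩`, `N ≥ 2`,
`M ≥ N^{1/3}`, with two-leg slack `N^η`.  `BoundedExponentThird ↔ ∃ ℓ, ∀ η > 0, DesignAt ℓ η`
(`boundedExponentThird_iff`, by `Iff.rfl`). -/
def DesignAt (ℓ : ℕ) (η : ℝ) : Prop :=
  ∃ (H : Type) (_ : AddCommGroup H) (_ : Fintype H) (L N M : ℕ) (A B C : Fin L → Finset H),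
    AddMonoid.exponent H ≤ ℓ ∧ IsSTPP A B C ∧
    (∀ i, (A i).card = N ∧ (B i).card = M ∧ (C i).card = N) ∧ 2 ≤ N ∧
    (N : ℝ) ^ (1 / 3 : ℝ) ≤ M ∧ (Fintype.card H : ℝ) ≤ L * (N : ℝ) ^ (2 + η)

theorem boundedExponentThird_iff : BoundedExponentThird ↔ ∃ ℓ, ∀ η : ℝ, 0 < η → DesignAt ℓ η :=
  Iff.rfl

/-- Slack levels are monotone: more slack is easier. -/
theorem DesignAt.mono {ℓ : ℕ} {η η' : ℝ} (h : DesignAt ℓ η) (hle : η ≤ η') : DesignAt ℓ η' := by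
  obtain ⟨H, i1, i2, L, N, M, A, B, C, hexp, hS, hc, hN, hM, hH⟩ := h
  refine ⟨H, i1, i2, L, N, M, A, B, C, hexp, hS, hc, hN, hM, hH.trans ?_⟩
  have hN1 : (1 : ℝ) ≤ N := by exact_mod_cast (by omega : 1 ≤ N)
  exact mul_le_mul_of_nonneg_left (Real.rpow_le_rpow_of_exponent_le hN1 (by linarith))
    (Nat.cast_nonneg _)

/-- Bookkeeping shared by all levels: `N ≥ 2` and `N^{1/3} ≤ M` force `M ≥ 2`. -/
theorem two_le_middle {N M : ℕ} (hN : 2 ≤ N) (hM : (N : ℝ) ^ (1 / 3 : ℝ) ≤ M) : 2 ≤ M := by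
  have h1 : (1 : ℝ) < (N : ℝ) ^ (1 / 3 : ℝ) :=
    Real.one_lt_rpow (by exact_mod_cast (by omega : 1 < N)) (by norm_num)
  have : (1 : ℝ) < M := h1.trans_le hM
  exact_mod_cast this

/-- Bookkeeping: the packing inequality forces a nonempty family (`|H| ≥ 1`). -/
theorem blocks_pos {H : Type*} [Fintype H] [Nonempty H] {L N : ℕ} {η : ℝ}
    (hH : (Fintype.card H : ℝ) ≤ L * (N : ℝ) ^ (2 + η)) : 0 < L := by
  rcases Nat.eq_zero_or_pos L with rfl | hL
  · have : (0 : ℝ) < Fintype.card H := by exact_mod_cast Fintype.card_pos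
    simp only [Nat.cast_zero, zero_mul] at hH
    linarith
  · exact hL

/-- **Any witness at slack `η` has many blocks:** `M − 1 ≤ L · (N^η − 1)` (from `two_leg_bound`).
In particular `L → ∞` as `η → 0` at fixed `N`, and `L ≥ (N^{1/3} − 1)/(N^η − 1)`. -/
theorem blocks_forced {H : Type*} [AddCommGroup H] [Fintype H] [DecidableEq H] {L : ℕ}
    {A B C : Fin L → Finset H} (h : IsSTPP A B C) {N M : ℕ} (hA : ∀ i, (A i).card = N)
    (hBc : ∀ i, (B i).card = M) (hC : ∀ i, (C i).card = N) (hM : 1 ≤ M) (hN : 1 ≤ N) {η : ℝ}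
    (hH : (Fintype.card H : ℝ) ≤ L * (N : ℝ) ^ (2 + η)) :
    ((M : ℝ) - 1) ≤ L * ((N : ℝ) ^ η - 1) := by
  have hL : 0 < L := blocks_pos hH
  have key := two_leg_bound h hA hBc hC hM ⟨0, hL⟩
  have hNpos : (0 : ℝ) < N := by exact_mod_cast hN
  have hN2 : (0 : ℝ) < (N : ℝ) * N := mul_pos hNpos hNpos
  have e1 : (N : ℝ) ^ (2 + η) = (N : ℝ) * N * (N : ℝ) ^ η := by
    rw [Real.rpow_add hNpos, Real.rpow_two, sq]
  have key' : ((L : ℝ) + ((M : ℝ) - 1)) * ((N : ℝ) * N) ≤ L * ((N : ℝ) * N * (N : ℝ) ^ η) := by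
    have := (Nat.cast_le (α := ℝ)).2 key
    push_cast [Nat.cast_sub hM] at this
    rw [← e1]; exact this.trans hH
  have : ((L : ℝ) + ((M : ℝ) - 1)) ≤ L * (N : ℝ) ^ η := by
    rw [show (L : ℝ) * ((N : ℝ) * N * (N : ℝ) ^ η) = (L * (N : ℝ) ^ η) * ((N : ℝ) * N) by ring]
      at key'
    exact le_of_mul_le_mul_right key' hN2
  linarith

/-- **The `η = 0` endpoint of the crux is false, for every exponent bound `ℓ`** (natural
strengthening refuted): exact two-leg tightness `|H| ≤ L N²` with `M ≥ N^{1/3}`, `N ≥ 2` is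
impossible in any finite abelian group — by `two_leg_bound`, `(L + M − 1) N² ≤ |H| ≤ L N²` forces
`M ≤ 1`.  So the crux is purely asymptotic (`η → 0⁺`); no finite design is "the" witness. -/
theorem not_designAt_zero (ℓ : ℕ) : ¬ DesignAt ℓ 0 := by
  rintro ⟨H, i1, i2, L, N, M, A, B, C, -, hS, hc, hN, hM, hH⟩
  classical
  have hM2 : 2 ≤ M := two_le_middle hN hM
  have := blocks_forced hS (fun i => (hc i).1) (fun i => (hc i).2.1) (fun i => (hc i).2.2)
    (by omega) (by omega) hH
  simp only [Real.rpow_zero, sub_self, mul_zero] at this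
  have : (2 : ℝ) ≤ M := by exact_mod_cast hM2
  linarith

end SlackLevels

/-! ## §3  Coherent middle sets certify nothing -/

section CommonMiddle

variable {H : Type*} [AddCommGroup H] [Fintype H] [DecidableEq H] {L : ℕ} {A B C : Fin L → Finset H}

/-- **Common middle pattern costs its full size.** If every middle set `B i` contains a translate
of one set `B₀`, then `W + B₀` is a direct sum: `(∑ᵢ |A i||C i|) · |B₀| ≤ |H|`.
(For `|B₀| = M` this is the trivial volume bound `L N² M ≤ |H|` of a single block, now for the
whole family: such designs certify only `ω(1,a,1) ≤ 2 + a`.) -/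
theorem card_mul_le_of_common_middle (h : IsSTPP A B C) (B₀ : Finset H)
    (hB₀ : ∀ i, ∃ x : H, B₀.image (· + x) ⊆ B i) :
    (∑ i, (A i).card * (C i).card) * B₀.card ≤ Fintype.card H := by
  rcases B₀.eq_empty_or_nonempty with rfl | hne
  · simp
  have hB : ∀ i, (B i).Nonempty := fun i => by
    obtain ⟨x, hx⟩ := hB₀ i
    obtain ⟨b, hb⟩ := hne
    exact ⟨b + x, hx (mem_image_of_mem _ hb)⟩
  rw [← card_packedSet h hB, ← card_product]
  refine le_trans (card_le_card_of_injOn (fun p => p.1 + p.2) (fun _ _ => mem_univ _) ?_)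
    (card_univ (α := H)).le
  rintro ⟨w, b⟩ hp ⟨w', b'⟩ hp' (he : w + b = w' + b')
  simp only [coe_product, Set.mem_prod, mem_coe, packedSet, mem_biUnion, mem_univ,
    true_and] at hp hp'
  obtain ⟨⟨i, hi⟩, hb⟩ := hp
  obtain ⟨⟨j, hj⟩, hb'⟩ := hp'
  obtain ⟨a, ha, c, hc, rfl⟩ := mem_legSet.1 hi
  obtain ⟨a', ha', c', hc', rfl⟩ := mem_legSet.1 hj
  by_cases hbb : b = b'
  · subst hbb
    exact Prod.ext (add_right_cancel he) rfl
  · exfalso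
    obtain ⟨x, hx⟩ := hB₀ i
    have hβ : b + x ∈ B i := hx (mem_image_of_mem _ hb)
    have hβ' : b' + x ∈ B i := hx (mem_image_of_mem _ hb')
    refine translate_not_mem h ha hc hβ' hβ (fun e => hbb (add_right_cancel e).symm) ha' hc' ?_
    rw [show (b + x) - (b' + x) = b - b' by abel, ← sub_eq_zero, ← sub_eq_zero.2 he]
    abel

/-- Arithmetic core of the "certify nothing" refutations: a family with the full middle
factor in its volume bound, `L N² M ≤ |H|`, cannot have two-leg slack `N^{1/6}` when
`M ≥ N^{1/3}`, `N ≥ 2`. -/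
theorem false_of_volume_bound {H : Type*} [Fintype H] {L N M : ℕ} (hL : 0 < L) (hN : 2 ≤ N)
    (hM : (N : ℝ) ^ (1 / 3 : ℝ) ≤ M) (hvol : L * (N * N) * M ≤ Fintype.card H)
    (hH : (Fintype.card H : ℝ) ≤ L * (N : ℝ) ^ (2 + 1 / 6 : ℝ)) : False := by
  have hNpos : (0 : ℝ) < N := by exact_mod_cast (by omega : 0 < N)
  have hN1 : (1 : ℝ) < N := by exact_mod_cast (by omega : 1 < N)
  have hLpos : (0 : ℝ) < L := by exact_mod_cast hL
  have e1 : (N : ℝ) ^ (2 + 1 / 6 : ℝ) = (N : ℝ) * N * (N : ℝ) ^ (1 / 6 : ℝ) := by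
    rw [Real.rpow_add hNpos, Real.rpow_two, sq]
  have key' : (L : ℝ) * (N * N) * M ≤ L * ((N : ℝ) * N * (N : ℝ) ^ (1 / 6 : ℝ)) := by
    have := (Nat.cast_le (α := ℝ)).2 hvol
    push_cast at this
    rw [← e1]; exact this.trans hH
  have hM6 : (M : ℝ) ≤ (N : ℝ) ^ (1 / 6 : ℝ) := by
    have h2 : (0 : ℝ) < (L : ℝ) * (N * N) := by positivity
    rw [show (L : ℝ) * ((N : ℝ) * N * (N : ℝ) ^ (1 / 6 : ℝ)) =
      (L : ℝ) * (N * N) * (N : ℝ) ^ (1 / 6 : ℝ) by ring] at key'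
    exact le_of_mul_le_mul_left key' h2
  have h6 : (1 : ℝ) < (N : ℝ) ^ (1 / 6 : ℝ) := Real.one_lt_rpow hN1 (by norm_num)
  have e3 : (N : ℝ) ^ (1 / 3 : ℝ) = (N : ℝ) ^ (1 / 6 : ℝ) * (N : ℝ) ^ (1 / 6 : ℝ) := by
    rw [← Real.rpow_add hNpos]; norm_num
  have : (N : ℝ) ^ (1 / 6 : ℝ) < (N : ℝ) ^ (1 / 3 : ℝ) := by
    rw [e3]; exact lt_mul_left (by linarith) h6
  linarith

/-- NATURAL STRENGTHENING: the crux with all middle sets translates of ONE pattern `B₀`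
(covers single-block designs `L = 1`, coset/product designs with a fixed middle factor, and the
CKSU `Cyc_n³` two-block example's shape). -/
def BoundedExponentThirdTranslateB : Prop :=
  ∃ ℓ : ℕ, ∀ η : ℝ, 0 < η → ∃ (H : Type) (_ : AddCommGroup H) (_ : Fintype H) (L N M : ℕ)
    (A B C : Fin L → Finset H) (B₀ : Finset H) (x : Fin L → H),
    (∀ i, B i = B₀.map (addRightEmbedding (x i))) ∧ AddMonoid.exponent H ≤ ℓ ∧ IsSTPP A B C ∧
    (∀ i, (A i).card = N ∧ (B i).card = M ∧ (C i).card = N) ∧ 2 ≤ N ∧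
    (N : ℝ) ^ (1 / 3 : ℝ) ≤ M ∧ (Fintype.card H : ℝ) ≤ L * (N : ℝ) ^ (2 + η)

theorem translateB_imp : BoundedExponentThirdTranslateB → BoundedExponentThird := by
  rintro ⟨ℓ, h⟩
  refine ⟨ℓ, fun η hη => ?_⟩
  obtain ⟨H, i1, i2, L, N, M, A, B, C, -, -, -, rest⟩ := h η hη
  exact ⟨H, i1, i2, L, N, M, A, B, C, rest⟩

/-- **Refuted strengthening:** translate-coherent middle sets give `L N² M ≤ |H| ≤ L N^{2+η}`,
i.e. `M ≤ N^η`, incompatible with `M ≥ N^{1/3}` once `η < 1/3`.  ANY witness of the crux must use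
middle sets that are not translates of a common pattern (more: no common sub-pattern of size
`> N^η`, by `card_mul_le_of_common_middle`). -/
theorem not_BoundedExponentThirdTranslateB : ¬ BoundedExponentThirdTranslateB := by
  rintro ⟨ℓ, h⟩
  obtain ⟨H, i1, i2, L, N, M, A, B, C, B₀, x, hBx, -, hS, hc, hN, hM, hH⟩ :=
    h (1 / 6) (by norm_num)
  classical
  have hL : 0 < L := blocks_pos hH
  have hB₀c : B₀.card = M := by
    rw [← (hc ⟨0, hL⟩).2.1, hBx, card_map]
  have key := card_mul_le_of_common_middle hS B₀ (fun i => ⟨x i, by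
    rw [hBx i, map_eq_image]; exact subset_rfl⟩)
  simp only [hc, sum_const, card_univ, Fintype.card_fin, smul_eq_mul, hB₀c] at key
  exact false_of_volume_bound hL hN hM key hH

end CommonMiddle

/-! ## §3b  Coherent LEG sets certify nothing either -/

section CosetLegs

variable {H : Type*} [AddCommGroup H] [Fintype H] [DecidableEq H] {L : ℕ} {A B C : Fin L → Finset H}

/-- **Coset leg sets cost the full middle factor.** If every leg set `U i = C i − A i` is a
translate `x i + V` of ONE finite subgroup `V` (a finset containing `0`, closed under
subtraction) — e.g. "linear" designs in `𝔽_pⁿ` whose blocks are affine subspaces with a common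
leg space `(A i − A i) ⊕ (C i − C i) = V` — then `(Σ_k |B k|) · |V| ≤ |H|`, i.e. `L M N² ≤ |H|`.
Mechanism: the `(B, C)`-translation structure makes the `V`-cosets `b − a_k − U_k`, `b ∈ B k`,
pairwise distinct over ALL pairs `(k, b)` (each contains `b − c ∈ B k − C k`, and lies inside
`(B i − C i) + (A i − A i)` when read in block `i`). -/
theorem sum_card_mul_le_of_coset_legs (h : IsSTPP A B C) (V : Finset H) (hV0 : (0 : H) ∈ V)
    (hVsub : ∀ v ∈ V, ∀ w ∈ V, v - w ∈ V) (x : Fin L → H)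
    (hUmem : ∀ k (y : H), y ∈ legSet A C k ↔ y - x k ∈ V) (hAne : ∀ i, (A i).Nonempty)
    (hCne : ∀ i, (C i).Nonempty) :
    (∑ k, (B k).card) * V.card ≤ Fintype.card H := by
  choose a ha using hAne
  have hVneg : ∀ v ∈ V, -v ∈ V := fun v hv => by simpa using hVsub 0 hV0 v hv
  have hVadd : ∀ v ∈ V, ∀ w ∈ V, v + w ∈ V := fun v hv w hw => by
    simpa using hVsub v hv (-w) (hVneg w hw)
  -- the cosets `X k b = (b - a k) - U k`
  let X : Fin L → H → Finset H := fun k b => V.image fun v => (b - a k - x k) + v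
  have hmemX : ∀ k b (y : H), y ∈ X k b ↔ y - (b - a k - x k) ∈ V := by
    intro k b y
    simp only [X, mem_image]
    constructor
    · rintro ⟨v, hv, rfl⟩; simpa using hv
    · intro hy; exact ⟨_, hy, by abel⟩
  -- (i) `b - c ∈ X k b` for `c ∈ C k`
  have hbc : ∀ k, ∀ b, ∀ c ∈ C k, b - c ∈ X k b := by
    intro k b c hc
    rw [hmemX]
    have : c - a k ∈ legSet A C k := mem_legSet.2 ⟨a k, ha k, c, hc, rfl⟩
    rw [hUmem] at this
    have := hVneg _ this
    convert this using 1; abel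
  -- (ii) elements of `X i b'` are `(b' - c') + (a' - a i)` with `a' ∈ A i`, `c' ∈ C i`
  have hXsub : ∀ i b', ∀ y ∈ X i b', ∃ a' ∈ A i, ∃ c' ∈ C i, y = (b' - c') + (a' - a i) := by
    intro i b' y hy
    rw [hmemX] at hy
    have : b' - a i - y ∈ legSet A C i := by
      rw [hUmem]
      have := hVneg _ hy
      convert this using 1; abel
    obtain ⟨a', ha', c', hc', he⟩ := mem_legSet.1 this
    refine ⟨a', ha', c', hc', ?_⟩
    have e : y = b' - a i - (c' - a') := by rw [he]; abel
    rw [e]; abel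
  -- two cosets that meet are nested (hence equal)
  have hXeq : ∀ k b i b', ¬ Disjoint (X k b) (X i b') → X k b ⊆ X i b' := by
    intro k b i b' hnd y hy
    obtain ⟨z, hz1, hz2⟩ := not_disjoint_iff.1 hnd
    rw [hmemX] at hy hz1 hz2 ⊢
    have := hVadd _ hz2 _ (hVsub _ hy _ hz1)
    convert this using 1; abel
  -- pairwise disjointness over all pairs `(k, b)`, `b ∈ B k`
  have hdisj : ∀ k b, b ∈ B k → ∀ i b', b' ∈ B i → (k ≠ i ∨ b ≠ b') →
      Disjoint (X k b) (X i b') := by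
    intro k b hb i b' hb' hne
    by_contra hnd
    have hsub := hXeq k b i b' hnd
    obtain ⟨c, hc⟩ := hCne k
    obtain ⟨a', ha', c', hc', he⟩ := hXsub i b' _ (hsub (hbc k b c hc))
    -- `he : b - c = (b' - c') + (a' - a i)`; STPP instance `(i, k, i)`
    have e2 : (a i - a') + (b - b') + (c' - c) = (b - c) - ((b' - c') + (a' - a i)) := by abel
    have key := h i k i a' ha' (a i) (ha i) b' hb' b hb c hc c' hc' (by rw [e2, he, sub_self])
    rcases hne with hki | hbb
    · exact hki key.1.symm
    · exact hbb key.2.2.2.1.symm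
  -- count: `(⟨k, b⟩, v) ↦ (b - a k - x k) + v` is injective on `(Σ k, B k) × V`
  let S : Finset ((Σ _ : Fin L, H) × H) := (Finset.univ.sigma fun k => B k) ×ˢ V
  have hinj : Set.InjOn (fun q : (Σ _ : Fin L, H) × H => (q.1.2 - a q.1.1 - x q.1.1) + q.2) ↑S := by
    rintro ⟨⟨k, b⟩, v⟩ hq ⟨⟨i, b'⟩, v'⟩ hq' (he : (b - a k - x k) + v = (b' - a i - x i) + v')
    simp only [S, coe_product, coe_sigma, Set.mem_prod, Set.mem_sigma_iff, coe_univ,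
      Set.mem_univ, true_and, mem_coe] at hq hq'
    have hy : (b - a k - x k) + v ∈ X k b := mem_image_of_mem _ hq.2
    have hy' : (b - a k - x k) + v ∈ X i b' := by rw [he]; exact mem_image_of_mem _ hq'.2
    have hnd : ¬ Disjoint (X k b) (X i b') := not_disjoint_iff.2 ⟨_, hy, hy'⟩
    have hki : k = i := by
      by_contra hki; exact hnd (hdisj k b hq.1 i b' hq'.1 (Or.inl hki))
    subst hki
    have hbb : b = b' := by
      by_contra hbb; exact hnd (hdisj k b hq.1 k b' hq'.1 (Or.inr hbb))
    subst hbb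
    have hvv : v = v' := add_left_cancel he
    subst hvv
    rfl
  have hS : S.card = (∑ k, (B k).card) * V.card := by
    simp only [S, card_product, card_sigma]
  rw [← hS]
  exact le_trans (card_le_card_of_injOn _ (fun _ _ => mem_univ _) hinj) (card_univ (α := H)).le

/-- NATURAL STRENGTHENING: the crux with leg sets `C i − A i` all cosets of one subgroup `V`
(stated without `Finset.image`: membership in `C i − A i` is `· − x i ∈ V`). -/
def BoundedExponentThirdCosetLegs : Prop :=
  ∃ ℓ : ℕ, ∀ η : ℝ, 0 < η → ∃ (H : Type) (_ : AddCommGroup H) (_ : Fintype H) (L N M : ℕ)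
    (A B C : Fin L → Finset H) (V : Finset H) (x : Fin L → H),
    ((0 : H) ∈ V ∧ (∀ v ∈ V, ∀ w ∈ V, v - w ∈ V) ∧
      ∀ i (y : H), (∃ a ∈ A i, ∃ c ∈ C i, c - a = y) ↔ y - x i ∈ V) ∧
    AddMonoid.exponent H ≤ ℓ ∧ IsSTPP A B C ∧
    (∀ i, (A i).card = N ∧ (B i).card = M ∧ (C i).card = N) ∧ 2 ≤ N ∧
    (N : ℝ) ^ (1 / 3 : ℝ) ≤ M ∧ (Fintype.card H : ℝ) ≤ L * (N : ℝ) ^ (2 + η)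

/-- It is a strengthening of the crux. -/
theorem cosetLegs_imp : BoundedExponentThirdCosetLegs → BoundedExponentThird := by
  rintro ⟨ℓ, h⟩
  refine ⟨ℓ, fun η hη => ?_⟩
  obtain ⟨H, i1, i2, L, N, M, A, B, C, -, -, -, rest⟩ := h η hη
  exact ⟨H, i1, i2, L, N, M, A, B, C, rest⟩

/-- **Refuted strengthening:** coset leg sets give `L N² M ≤ |H|` (`sum_card_mul_le_of_coset_legs`),
incompatible with two-leg slack `N^η`, `η < 1/3`.  Linear designs with a common leg space are out;
witnesses need leg sets with INCOHERENT stabilisers (cf. the parallel-`U` example in §5). -/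
theorem not_BoundedExponentThirdCosetLegs : ¬ BoundedExponentThirdCosetLegs := by
  rintro ⟨ℓ, h⟩
  obtain ⟨H, i1, i2, L, N, M, A, B, C, V, x, ⟨hV0, hVsub, hUV⟩, -, hS, hc, hN, hM, hH⟩ :=
    h (1 / 6) (by norm_num)
  classical
  have hL : 0 < L := blocks_pos hH
  have hAne : ∀ i, (A i).Nonempty := fun i => card_pos.1 (by rw [(hc i).1]; omega)
  have hBne : ∀ i, (B i).Nonempty := fun i =>
    card_pos.1 (by rw [(hc i).2.1]; have := two_le_middle hN hM; omega)
  have hCne : ∀ i, (C i).Nonempty := fun i => card_pos.1 (by rw [(hc i).2.2]; omega)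
  have hUmem : ∀ k (y : H), y ∈ legSet A C k ↔ y - x k ∈ V := fun k y => by
    rw [mem_legSet]; exact hUV k y
  -- `|V| = N²`
  have hVc : V.card = N * N := by
    have e : legSet A C ⟨0, hL⟩ = V.image (x ⟨0, hL⟩ + ·) := by
      ext y
      rw [hUmem, mem_image]
      constructor
      · intro hy; exact ⟨_, hy, by abel⟩
      · rintro ⟨v, hv, rfl⟩; simpa using hv
    rw [← card_image_of_injective V (add_right_injective (x ⟨0, hL⟩)), ← e,
      card_legSet hS (hBne _), (hc _).1, (hc _).2.2]
  have key := sum_card_mul_le_of_coset_legs hS V hV0 hVsub x hUmem hAne hCne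
  simp only [hc, sum_const, card_univ, Fintype.card_fin, smul_eq_mul, hVc] at key
  exact false_of_volume_bound hL hN hM (by simpa [mul_comm, mul_assoc, mul_left_comm] using key) hH

end CosetLegs

/-! ## §3c  One translate-coherent OUTER family already certifies nothing -/

section TranslateOuter

variable {H : Type*} [AddCommGroup H] [Fintype H] {L : ℕ} {A B C : Fin L → Finset H}

/-- **Translate-coherent first family costs the full volume.** If all `A i` are translates of one
set `A₀`, then `((k, b, c), a₀) ↦ (b − c) + a₀` is injective on `(Σ_k B k × C k) × A₀`
(the `(B,C)`-translation mechanism, STPP instance `(i, k, i)`), so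
`(Σ_k |B k||C k|)·|A₀| ≤ |H|` — the full volume bound `L·N·M·N ≤ |H|`.  With `IsSTPP.rotate` the
same holds for the third family (`card_mul_le_of_translate_third`), and §3 is the middle one:
if ANY ONE of the three families is translate-coherent the design certifies only `ω(1,a,1) ≤ 2+a`. -/
theorem card_mul_le_of_translate_first (h : IsSTPP A B C) (A₀ : Finset H) (x : Fin L → H)
    (hA : ∀ i, A i = A₀.map (addRightEmbedding (x i))) :
    (∑ k, (B k).card * (C k).card) * A₀.card ≤ Fintype.card H := by
  let S : Finset ((Σ _ : Fin L, H × H) × H) := (Finset.univ.sigma fun k => B k ×ˢ C k) ×ˢ A₀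
  have hmemA : ∀ i, ∀ a₀ ∈ A₀, a₀ + x i ∈ A i := fun i a₀ ha₀ => by
    rw [hA i]; exact mem_map_of_mem _ ha₀
  have hinj : Set.InjOn (fun q : (Σ _ : Fin L, H × H) × H => (q.1.2.1 - q.1.2.2) + q.2) ↑S := by
    rintro ⟨⟨k, b, c⟩, a₀⟩ hq ⟨⟨i, b', c'⟩, a₀'⟩ hq' (he : (b - c) + a₀ = (b' - c') + a₀')
    simp only [S, coe_product, coe_sigma, Set.mem_prod, Set.mem_sigma_iff, coe_univ,
      Set.mem_univ, true_and, mem_coe] at hq hq'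
    have e2 : ((a₀ + x i) - (a₀' + x i)) + (b - b') + (c' - c) =
        ((b - c) + a₀) - ((b' - c') + a₀') := by abel
    have key := h i k i (a₀' + x i) (hmemA i _ hq'.2) (a₀ + x i) (hmemA i _ hq.2) b' hq'.1.1
      b hq.1.1 c hq.1.2 c' hq'.1.2 (by rw [e2, he, sub_self])
    obtain ⟨rfl, -, h1, h2, h3⟩ := key
    have h1' : a₀ = a₀' := (add_right_cancel h1).symm
    subst h1'; subst h2; subst h3
    rfl
  have hS : S.card = (∑ k, (B k).card * (C k).card) * A₀.card := by
    simp only [S, card_product, card_sigma]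
  rw [← hS]
  exact le_trans (card_le_card_of_injOn _ (fun _ _ => mem_univ _) hinj) (card_univ (α := H)).le

/-- The same for the third family, by the cyclic symmetry `IsSTPP.rotate`. -/
theorem card_mul_le_of_translate_third (h : IsSTPP A B C) (C₀ : Finset H) (x : Fin L → H)
    (hC : ∀ i, C i = C₀.map (addRightEmbedding (x i))) :
    (∑ k, (A k).card * (B k).card) * C₀.card ≤ Fintype.card H :=
  card_mul_le_of_translate_first h.rotate.rotate C₀ x hC

/-- NATURAL STRENGTHENING: the crux with a translate-coherent FIRST family `A i = A₀ + x i`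
(middle and third families arbitrary). -/
def BoundedExponentThirdTranslateA : Prop :=
  ∃ ℓ : ℕ, ∀ η : ℝ, 0 < η → ∃ (H : Type) (_ : AddCommGroup H) (_ : Fintype H) (L N M : ℕ)
    (A B C : Fin L → Finset H) (A₀ : Finset H) (x : Fin L → H),
    (∀ i, A i = A₀.map (addRightEmbedding (x i))) ∧ AddMonoid.exponent H ≤ ℓ ∧ IsSTPP A B C ∧
    (∀ i, (A i).card = N ∧ (B i).card = M ∧ (C i).card = N) ∧ 2 ≤ N ∧
    (N : ℝ) ^ (1 / 3 : ℝ) ≤ M ∧ (Fintype.card H : ℝ) ≤ L * (N : ℝ) ^ (2 + η)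

/-- It is a strengthening of the crux. -/
theorem translateA_imp : BoundedExponentThirdTranslateA → BoundedExponentThird := by
  rintro ⟨ℓ, h⟩
  refine ⟨ℓ, fun η hη => ?_⟩
  obtain ⟨H, i1, i2, L, N, M, A, B, C, -, -, -, rest⟩ := h η hη
  exact ⟨H, i1, i2, L, N, M, A, B, C, rest⟩

/-- **Refuted strengthening:** one translate-coherent outer family gives `L N² M ≤ |H|`, hence no
two-leg slack below `N^{1/3}`.  Together with §3 (middle) and `card_mul_le_of_translate_third`:
in a witness NONE of the three families can consist of translates of a single set. -/
theorem not_BoundedExponentThirdTranslateA : ¬ BoundedExponentThirdTranslateA := by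
  rintro ⟨ℓ, h⟩
  obtain ⟨H, i1, i2, L, N, M, A, B, C, A₀, x, hAx, -, hS, hc, hN, hM, hH⟩ :=
    h (1 / 6) (by norm_num)
  classical
  have hL : 0 < L := blocks_pos hH
  have hA₀c : A₀.card = N := by
    rw [← (hc ⟨0, hL⟩).1, hAx, card_map]
  have key := card_mul_le_of_translate_first hS A₀ x hAx
  simp only [hc, sum_const, card_univ, Fintype.card_fin, smul_eq_mul, hA₀c] at key
  exact false_of_volume_bound hL hN hM
    (by simpa [mul_comm, mul_assoc, mul_left_comm] using key) hH

end TranslateOuter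

/-! ## §4  In bounded exponent the blocks must grow (tree Thm A + §1) -/

section BlocksGrow

/-- An STPP family with chosen elements `a i ∈ A i`, `b i ∈ B i`, `c i ∈ C i` yields a tricolored
sum-free set of size `L` (BCCGNSU 2017 §3.1, the `N = 1` case of Thm 3.3): the triples
`(a i − b i, b i − c i, c i − a i)`. -/
theorem isTricoloredSumFree_of_isSTPP {H : Type*} [AddCommGroup H] {L : ℕ}
    {A B C : Fin L → Finset H} (h : IsSTPP A B C) (a b c : Fin L → H)
    (ha : ∀ i, a i ∈ A i) (hb : ∀ i, b i ∈ B i) (hc : ∀ i, c i ∈ C i) :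
    Literature.Combinatorics.Additive.IsTricoloredSumFree
      (fun i => a i - b i) (fun i => b i - c i) (fun i => c i - a i) := by
  intro i j k
  constructor
  · intro he
    have e : (a i - a k) + (b j - b i) + (c k - c j) = (a i - b i) + (b j - c j) + (c k - a k) := by
      abel
    have key := h i j k (a k) (ha k) (a i) (ha i) (b i) (hb i) (b j) (hb j) (c j) (hc j) (c k)
      (hc k) (by rw [e, he])
    exact ⟨key.1, key.2.1⟩
  · rintro ⟨rfl, rfl⟩
    show (a i - b i) + (b i - c i) + (c i - a i) = 0
    abel

/-- **Few blocks in bounded exponent** (tree Thm A `exists_tricoloredSumFree_card_le` applied to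
the tricolored sum-free set of `isTricoloredSumFree_of_isSTPP`): for every `ℓ` there is `δ > 0`
with `L ≤ 3 |H|^{1−δ}` for every STPP family with nonempty sets in an abelian group of exponent
`≤ ℓ`. -/
theorem card_blocks_le (ℓ : ℕ) : ∃ δ : ℝ, 0 < δ ∧ ∀ (H : Type) [AddCommGroup H] [Fintype H],
    AddMonoid.exponent H ≤ ℓ → ∀ (L : ℕ) (A B C : Fin L → Finset H), IsSTPP A B C →
      (∀ i, (A i).Nonempty) → (∀ i, (B i).Nonempty) → (∀ i, (C i).Nonempty) →
        (L : ℝ) ≤ 3 * (Fintype.card H : ℝ) ^ (1 - δ) := by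
  obtain ⟨δ, hδ, hA⟩ := Literature.Combinatorics.Additive.exists_tricoloredSumFree_card_le.{0, 0} ℓ
  refine ⟨δ, hδ, fun H _ _ hexp L A B C h hAne hBne hCne => ?_⟩
  have := hA H hexp (Fin L) _ _ _ (isTricoloredSumFree_of_isSTPP h (fun i => (hAne i).choose)
    (fun i => (hBne i).choose) (fun i => (hCne i).choose) (fun i => (hAne i).choose_spec)
    (fun i => (hBne i).choose_spec) (fun i => (hCne i).choose_spec))
  simpa using this

/-- NATURAL STRENGTHENING: the crux with blocks of BOUNDED size (`N ≤ N₀` uniformly in `η`). -/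
def BoundedExponentThirdBoundedN : Prop :=
  ∃ ℓ N₀ : ℕ, ∀ η : ℝ, 0 < η → ∃ (H : Type) (_ : AddCommGroup H) (_ : Fintype H) (L N M : ℕ)
    (A B C : Fin L → Finset H), N ≤ N₀ ∧ AddMonoid.exponent H ≤ ℓ ∧ IsSTPP A B C ∧
    (∀ i, (A i).card = N ∧ (B i).card = M ∧ (C i).card = N) ∧ 2 ≤ N ∧
    (N : ℝ) ^ (1 / 3 : ℝ) ≤ M ∧ (Fintype.card H : ℝ) ≤ L * (N : ℝ) ^ (2 + η)

theorem boundedN_imp : BoundedExponentThirdBoundedN → BoundedExponentThird := by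
  rintro ⟨ℓ, N₀, h⟩
  refine ⟨ℓ, fun η hη => ?_⟩
  obtain ⟨H, i1, i2, L, N, M, A, B, C, -, rest⟩ := h η hη
  exact ⟨H, i1, i2, L, N, M, A, B, C, rest⟩

/-- **Refuted strengthening: witness blocks must grow as `η → 0`.**  For fixed `ℓ, N₀`:
Thm A bounds `L ≤ 3|H|^{1−δ}`, the packing gives `|H| ≤ L N₀³`, hence `|H| ≤ K := (3N₀³)^{1/δ}`
and `L ≤ K`; but `two_leg_bound` gives `1 + 1/L ≤ N^η ≤ N₀^η`, false once `N₀^η < 1 + 1/K`.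
Consequence for design hunters: finite searches (fixed block gadgets, any number of copies, any
group of exponent `≤ ℓ`) can calibrate but can never witness the crux; `N ≥ |H|^{c·δ_ℓ}` is forced. -/
theorem not_BoundedExponentThirdBoundedN : ¬ BoundedExponentThirdBoundedN := by
  rintro ⟨ℓ, N₀, h⟩
  by_cases hN₀ : N₀ < 2
  · obtain ⟨H, i1, i2, L, N, M, A, B, C, hNN, -, -, -, hN, -⟩ := h 1 one_pos
    omega
  push Not at hN₀
  obtain ⟨δ, hδ, hblocks⟩ := card_blocks_le ℓ
  have hN₀1 : (1 : ℝ) < N₀ := by exact_mod_cast (by omega : 1 < N₀)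
  have hN₀0 : (0 : ℝ) < N₀ := by linarith
  -- the a-priori bound on |H|
  set K : ℝ := (3 * (N₀ : ℝ) ^ (3 : ℝ)) ^ (1 / δ) with hK
  have h3N : (1 : ℝ) ≤ 3 * (N₀ : ℝ) ^ (3 : ℝ) := by
    have : (1 : ℝ) ≤ (N₀ : ℝ) ^ (3 : ℝ) := Real.one_le_rpow hN₀1.le (by norm_num)
    linarith
  have hK1 : 1 ≤ K := Real.one_le_rpow h3N (by positivity)
  have hK0 : 0 < K := by linarith
  set ε : ℝ := 1 + 1 / K with hε
  have hε1 : 1 < ε := by rw [hε]; simp [hK0]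
  set η₁ : ℝ := Real.logb N₀ ε / 2 with hη₁
  have hη₁0 : 0 < η₁ := by
    have := Real.logb_pos hN₀1 hε1
    rw [hη₁]; linarith
  set η : ℝ := min 1 η₁ with hη
  have hη0 : 0 < η := lt_min one_pos hη₁0
  have hηle1 : η ≤ 1 := min_le_left _ _
  have hηle : η ≤ η₁ := min_le_right _ _
  -- the design at slack η
  obtain ⟨H, i1, i2, L, N, M, A, B, C, hNN, hexp, hS, hc, hN, hM, hH⟩ := h η hη0
  classical
  have hM2 : 2 ≤ M := two_le_middle hN hM
  have hL : 0 < L := blocks_pos hH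
  have hN1 : (1 : ℝ) ≤ N := by exact_mod_cast (by omega : 1 ≤ N)
  have hAne : ∀ i, (A i).Nonempty := fun i => card_pos.1 (by rw [(hc i).1]; omega)
  have hBne : ∀ i, (B i).Nonempty := fun i => card_pos.1 (by rw [(hc i).2.1]; omega)
  have hCne : ∀ i, (C i).Nonempty := fun i => card_pos.1 (by rw [(hc i).2.2]; omega)
  have hcard0 : (0 : ℝ) < Fintype.card H := by exact_mod_cast Fintype.card_pos
  -- (i) few blocks
  have hL3 : (L : ℝ) ≤ 3 * (Fintype.card H : ℝ) ^ (1 - δ) := hblocks H hexp L A B C hS hAne hBne hCne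
  -- (ii) |H| ≤ L N₀³
  have hH3 : (Fintype.card H : ℝ) ≤ L * (N₀ : ℝ) ^ (3 : ℝ) := by
    refine hH.trans (mul_le_mul_of_nonneg_left ?_ (Nat.cast_nonneg _))
    calc (N : ℝ) ^ (2 + η) ≤ (N : ℝ) ^ (3 : ℝ) :=
          Real.rpow_le_rpow_of_exponent_le hN1 (by linarith)
      _ ≤ (N₀ : ℝ) ^ (3 : ℝ) :=
          Real.rpow_le_rpow (by linarith) (by exact_mod_cast hNN) (by norm_num)
  -- (iii) |H| ≤ K
  have hHK : (Fintype.card H : ℝ) ≤ K := by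
    have hsplit : (Fintype.card H : ℝ) =
        (Fintype.card H : ℝ) ^ (1 - δ) * (Fintype.card H : ℝ) ^ δ := by
      rw [← Real.rpow_add hcard0]; simp
    have hpow : (Fintype.card H : ℝ) ^ δ ≤ 3 * (N₀ : ℝ) ^ (3 : ℝ) := by
      have h1 : (0 : ℝ) < (Fintype.card H : ℝ) ^ (1 - δ) := Real.rpow_pos_of_pos hcard0 _
      have h2 : (Fintype.card H : ℝ) ^ (1 - δ) * (Fintype.card H : ℝ) ^ δ ≤
          (Fintype.card H : ℝ) ^ (1 - δ) * (3 * (N₀ : ℝ) ^ (3 : ℝ)) := by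
        calc _ = (Fintype.card H : ℝ) := hsplit.symm
          _ ≤ L * (N₀ : ℝ) ^ (3 : ℝ) := hH3
          _ ≤ 3 * (Fintype.card H : ℝ) ^ (1 - δ) * (N₀ : ℝ) ^ (3 : ℝ) :=
              mul_le_mul_of_nonneg_right hL3 (by positivity)
          _ = _ := by ring
      exact le_of_mul_le_mul_left h2 h1
    have h3 : (Fintype.card H : ℝ) = ((Fintype.card H : ℝ) ^ δ) ^ (1 / δ) := by
      rw [← Real.rpow_mul hcard0.le, mul_one_div_cancel hδ.ne', Real.rpow_one]
    rw [h3, hK]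
    exact Real.rpow_le_rpow (by positivity) hpow (by positivity)
  -- (iv) L ≤ K
  have hLK : (L : ℝ) ≤ K := by
    have key := two_leg_bound hS (fun i => (hc i).1) (fun i => (hc i).2.1) (fun i => (hc i).2.2)
      (by omega) ⟨0, hL⟩
    have : L ≤ Fintype.card H := by
      have hNN1 : 1 ≤ N * N := Nat.one_le_iff_ne_zero.2 (by positivity)
      nlinarith
    exact le_trans (by exact_mod_cast this) hHK
  -- (v) N^η ≥ 1 + 1/K
  have hforced := blocks_forced hS (fun i => (hc i).1) (fun i => (hc i).2.1) (fun i => (hc i).2.2)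
    (by omega) (by omega) hH
  have hLpos : (0 : ℝ) < L := by exact_mod_cast hL
  have hNη : ε ≤ (N : ℝ) ^ η := by
    have hM1 : (1 : ℝ) ≤ (M : ℝ) - 1 := by
      have : (2 : ℝ) ≤ M := by exact_mod_cast hM2
      linarith
    have h1 : 1 ≤ (L : ℝ) * ((N : ℝ) ^ η - 1) := hM1.trans hforced
    have h2 : 1 / K ≤ (N : ℝ) ^ η - 1 := by
      rw [div_le_iff₀ hK0]
      calc (1 : ℝ) ≤ (L : ℝ) * ((N : ℝ) ^ η - 1) := h1
        _ ≤ K * ((N : ℝ) ^ η - 1) := by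
            apply mul_le_mul_of_nonneg_right hLK
            by_contra hneg
            push Not at hneg
            nlinarith
        _ = ((N : ℝ) ^ η - 1) * K := by ring
    rw [hε]; linarith
  -- (vi) N^η ≤ N₀^{η₁} = ε^{1/2} < ε
  have hup : (N : ℝ) ^ η < ε := by
    calc (N : ℝ) ^ η ≤ (N₀ : ℝ) ^ η :=
          Real.rpow_le_rpow (by linarith) (by exact_mod_cast hNN) hη0.le
      _ ≤ (N₀ : ℝ) ^ η₁ := Real.rpow_le_rpow_of_exponent_le hN₀1.le hηle
      _ = ε ^ (1 / 2 : ℝ) := by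
          rw [hη₁, div_eq_mul_one_div, Real.rpow_mul hN₀0.le,
            Real.rpow_logb hN₀0 hN₀1.ne' (by linarith)]
      _ < ε ^ (1 : ℝ) := Real.rpow_lt_rpow_of_exponent_lt hε1 (by norm_num)
      _ = ε := Real.rpow_one ε
  linarith

end BlocksGrow

/-! ## §5  Why the crux resists (and what a kill must look like)

**What is proved above constrains witnesses but does not kill.**  With `W = ⊔ U_i`, `ρ := L N²/|H|`
(two-leg density; the crux asks `ρ ≥ N^{-η}` for every `η > 0`):
* `ρ ≤ L/(L + M − 1)` (§1) — so `L ≳ M/(η log N)` blocks; `L = O(M)` is impossible but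
  `L = M·polylog` is not excluded;
* translate-coherent middle sets give `ρ ≤ 1/M` (§3) — witnesses need middle sets with no common
  sub-pattern of size `> N^η`;
* bounded exponent + Thm A force `N → ∞`, indeed `N ≥ |H|^{Ω(δ_ℓ)}` (§4 and the planner's a₀
  computation), so every finite search is calibration only.

**Why no cheap kill.**  ¬BoundedExponentThird is literally `RectangularThmB` at `a = 1/3` for every
`ℓ` (twin crux 10597; `thmB_kills_third` of earlier refuters).  Every DEGENERATION-MONOTONE
invariant `f` (slice rank, partition/analytic/G-stable rank, Strassen support functionals) applied to
`⊕_L ⟨N,M,N⟩ ≤ D_H` sees at most the asymptotic subrank `L·N·M` of the block sum (the short-leg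
quantity `Σ|A_i||B_i|`), and `L N M ≤ |H|^{1−δ_ℓ}` contradicts `|H| ≤ L N^{2+η}` only when
`N^{1−a} < |H|^{δ_ℓ}`, i.e. for `a > a₀(ℓ)`: uniform θ gives `a₀ = (2−6δ)/(2+3δ) ≈ 0.67–0.73`,
the optimal asymmetric support functional gives `a₀* = 0.52–0.60` (twin triage r1-1, q = 2…7) —
never `1/3`.  Sharper: the support functionals are spectral points (Strassen; `D_H` is free/tight),
so IF they exhaust the asymptotic spectrum on these tensors (open, widely expected), then for
`a < a₀*(ℓ)` the block sum `⊕_L ⟨N, N^a, N⟩` with `|H| = L N^{2+η}` IS an ASYMPTOTIC restriction of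
`D_H` — no restriction-monotone, tensor-power-stable argument can ever refute it; a kill at
`a = 1/3` must use the single-shot PRODUCT structure of STPP (sets `A_i, B_i, C_i`, as the
translation mechanism does), not just `D_H ≥ ⊕ blocks`.  Two-direction ("no z-slices") slice
rank of `D_H` is `Θ(|H|)` (the `a = 0` coset tilings are exactly two-leg tight with `M = 1`), so
an invariant that ignores the middle leg cannot work either: a kill needs
`f(⊕_L⟨N,M,N⟩) ≥ L·N²·M^{κ}` together with `f(D_H) ≤ |H|·N^{o(1)}` in exponent `ℓ` for some
STPP-monotone (not merely restriction-monotone) `f` that USES `M ≥ N^{1/3}`.  None is known.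

**The heuristic case against the crux (random vs. linear).**  Condition
`(U_i + d) ∩ W = ∅` asks an `N²`-set to avoid a set of density `ρ ≥ N^{-η}`: a random-like `W`
does this with probability `(1−ρ)^{N²}` — designs must be rigidly structured; but the structured
(linear/coset) designs are exactly the ones §3/§3b kill by coset counting.  Known STPP families
with volume excess (`Cyc_n³` tensor powers, USP designs) have `ρ ≈ M^{-0.8…}` at best versus the
required `ρ ≥ M^{-3η}`.

**The combinatorial core (all that STPP gives cheaply).**  With `Q_i = A_i − B_i`, `T_j = B_j − C_j`,
`U_k = C_k − A_k`: STPP ⟺ TPP per block ∧ `0 ∉ Q_i + T_j + U_k` for `(i,j,k)` not all equal.  The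
two-index specialisations are exactly three "translation mechanisms" (§1 is the `(A,C)` one):
`(U_i + (B_i−B_i)∖0) ∩ W = ∅`, `(T_i + (A_i−A_i)∖0) ∩ T = ∅`, `(Q_i + (C_i−C_i)∖0) ∩ Q = ∅`.
Equivalently: for every `b ∈ B_i`, the translate `W + b` meets `S_i := U_i + B_i` (`|S_i| = N²M`)
in exactly `U_i + b`; the translates `{W + b : b ∈ B_i}` PARTITION `S_i`.  A random `W` of density
`ρ` would meet `S_i` in `ρ N² M` points per translate, so witnesses are `ρM`-fold depleted — the
heuristic reason to expect `ρ ≲ 1/M` (which would kill the crux AND `ThinPackings`), but STPP does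
not control the 8-term coincidences `u_i + d_i = u_j + d_j` that a proof by double counting needs:
some point of `H ∖ W` must lie in `U_i + (B_i − B_i)∖0` for `≥ (M−1)/(N^η−1) ≈ N^{1/3−η}` blocks `i`
simultaneously (Σ_i |U_i + D_i'| ≥ L N²(M−1) incidences into `|H ∖ W| ≤ L N²(N^η − 1)` points).

**A construction that dies instructively** (`F₂ⁿ`, `M = 2`, all `U_i` parallel with direction space
`V`, `E := H ∖ W` one more `V`-coset, so `ρ = 1 − N²/|H|`): the `(B,C)`-mechanism makes
`T_i + (A_i − A_i) ⊇` the two `V`-cosets through `b_i + c_i` and `b_i + c_i + β_i`, which must avoid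
every `T_k`, `k ≠ i`, while `T_k` meets both of ITS two cosets — so the `2L` cosets are distinct,
`2L ≤ |H/V| = L + 1`, `L ≤ 1`.  Incoherence of the `U_i`-directions is forced as well.

**Reformulation by a figure of merit (for designers and for the compute calibration).**  For a
design `D` (exponent-`ℓ` STPP family, uniform blocks `⟨N, M, N⟩`, `M ≥ 2`) put
`κ(D) := log(|H|/(L N²)) / log M` (two-leg slack measured in powers of the middle size; packing
`L N M ≤ |H|` forces `N ≥ M^{1−κ}`, and `κ ≤ 1` iff `ρ ≥ 1/M`).  Tensor powers keep `κ`, and the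
product with a coset tiling (`X × 0, {0}, 0 × Z` in `(ℤ/ℓ)^{2s}`, two-leg density 1) multiplies
`N` only; hence (standard product constructions, not formalised here)
  `BoundedExponentThird ⟺ ∃ ℓ ∀ κ > 0 ∃ ONE exponent-ℓ design with M³ ≥ N and |H| ≤ L·N²·M^κ`
(`⇒`: a witness at slack `η` has `κ ≤ 3η`; `⇐`: power up, thin to `M³ ∈ [N, ℓN)`, slack
`M^κ ≤ (ℓN)^{κ/3}`).  So the crux is about the trade-off between two-leg density and middle size
for designs of ANY size — one good finite design seeds an infinite family — but designs thinner
than `a = 1/3` cannot be fattened (no two-leg-tight middle tiling exists, by §1).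
CALIBRATION: for BALANCED designs (`M = N`) `κ(D) = ω_D − 2` where `ω_D` is the exponent bound the
design certifies via CKSU Thm 5.5 (`L N^{ω_D} = |H|`), so Thm B reads `κ ≥ ε_ℓ` on balanced
designs, and thinning a balanced design never beats `ε_ℓ`.  Best KNOWN bounded-exponent values:
`κ = 0.479` (CKSU 2005 Prop 18 + Prop 34 + Thm 33: local strong USPs of capacity `2^{2/3}` in
`Cyc₆ⁿ`, the `ω < 2.48` designs; thinned: `|H| ≈ L N^{2.16}` at `a = 1/3`), `κ = 0.816` for the
two-block `Cyc₁₆³` design and its powers (`|H| ≈ L N^{2.27}`); and — if the ideator's numbers in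
`Ideas/symmetrised-skew-strong-usp.md` are right (padded two-symbol triangle puzzles: rate
`2^{0.562}` at 2-density `1/6`, `2^{0.524}` at `1/7`, versus the zero-loss rates `2^{0.650}`,
`2^{0.592}`) — `κ ≈ 0.088/0.387 = 0.23` (`ℓ = 6`, `a = 2/5`) and `κ ≈ 0.068/0.369 = 0.18`
(`ℓ = 7`, `a = 1/3`), i.e. `|H| ≈ L N^{2.06}` at `a = 1/3`: natively skew USP designs ARE the best
known, and they sit a definite distance from zero loss (two-symbol puzzles cannot reach it, CKSU
Cor 19).  Side remark (cheap, checked): every local strong USP is a CAP SET in `𝔽₃ⁿ` (for an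
algebraic line `(x, x+d, x+2d)` read as `(u,v,w)` no column has "exactly two of `u=1, v=2, w=3`"),
but Ellenberg–Gijswijt (`2.756ⁿ`) exceeds the skew layer (`2.730ⁿ`), and NO affine `𝔽₃`-form
vanishes on the six USP patterns while missing the diagonal (exhaustive check), so the polynomial
method in this form gives nothing against the engine either.  The crux asks for `κ → 0`, which
must come from NATIVELY thin designs (`N ≫ M`, shape `a ∈ [1/3, a₀(ℓ))`), a regime with no
construction and no obstruction in print.  Small cases: `⟨2,2,2⟩` blocks in `𝔽₂ⁿ` have
`κ = n − 2 − log₂ L`; the a-priori cap `L ≤ 2^{n−2} − 1` is NOT attainable (then `|E| = 4` forces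
all `U_i + β_i = E`, all `U_i` parallel, `L ≤ 1` by the `(B,C)`-coset count of the example
below), so `L ≤ 2^{n−2} − 2`, `κ ≥ log₂(2^{n−2}/(2^{n−2}−2))`; whether anything near it is
attainable is what the kit jobs probe (`n = 5`: `L = 6` would be `κ = 0.42`; `n = 6`: `L = 14`
would be `κ = 0.19`, already far below every known design).

FIRST DATA (local toy runs of `compute/f2_222.py`, `compute/f2_flats.py`, `compute/tsf_f2.py`; kit jobs
j008225/j009055 queued): for `⟨2,2,2⟩` blocks in `𝔽₂ⁿ` the STPP conditions linearise — a block is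
`(p, q; α, β, γ)` with `α, β, γ` independent, `Σ = ⟨α,β,γ⟩`, and STPP ⟺
`p_i + q_j + p_k + q_k ∉ ⟨α_i,β_i,β_j,γ_j,γ_k,α_k⟩` for `(i,j,k)` not all equal — and designs whose
blocks share one `Σ` are EXACTLY tricolored sum-free sets in `𝔽₂^{n−3}` (sizes `τ(1..4) = 1, 2, 2, 6`,
exhaustive), i.e. TSF ⊗ (one block), two-leg density `τ(m)/2^{m+1} ≤ 1/4`.  Exhaustive/heuristic
maxima: `L_max(4) = 1` (proved: `H/Σ ≅ 𝔽₂` forces `φ(r₂) = φ(r₁)` and `≠` at once), `L(5) = 2`,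
`L(6) ≥ 3`, `L(7) ≥ 6` — densities `≤ 1/4 = 1/(2M)`, `κ ≥ 1.4`: in characteristic 2 tiny blocks do
not even reach the coherent bound `ρ = 1/M`.  Flat `⟨4,2,4⟩`, `⟨4,4,4⟩` blocks in `𝔽₂⁷, 𝔽₂⁸`:
heuristics find only the TSF products (`L = 2–3`).  Odd order is no better for tiny blocks
(`compute/ab_222.py`, general abelian model, smoke job j008225 agrees): `Z₃³` rediscovers CKSU's
two-block design (`ρ = 0.296`) every run, but `Z₄³, Z₉², Z₃⁴: L = 3`, `Z₅³: 3` (`ρ = 0.096`),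
`Z₆₄: 2` (`ρ = 1/8`, cap 15) — the exclusion zone `r_i − (DQ_i + DT_i) ⊇ U_i` of a block has up to
`4|U_i|` points in odd characteristic versus `2|U_i|` in characteristic 2; in general it is a
translate of `U_i + (B_i − B_i)`, of size `≈ N²·|B_i − B_i|`, so only SMALL-DOUBLING middle sets
(near-cosets of subgroups `K_i`, varying with `i` by §3/§3b) keep a block's footprint near `N²M`;
generic middle sets cost `≈ N² M²`.  Nothing found anywhere near `κ < 1`.

**Regimes still open for a witness** (for the provers): `N ≥ |H|^{c}`, `M = N^{1/3}`,
`L ∈ [M/(η log N), 3|H|^{1−δ_ℓ}]`, middle sets pairwise translate-incoherent, leg sets `U_i` with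
incoherent stabilisers; the USP engine (crux SkewLocalStrongUSP) lives here, with the extra burden
that its product structure reduces two-leg tightness to near-capacity puzzles (twin triage: the
signed-halves variant needs cap sets at 99.1% of the Ellenberg–Gijswijt exponent).

**Compute (kit jobs, evidence on the item):** heuristic maximum of `ρ` for `⟨2,2,2⟩`, `⟨4,2,4⟩`,
`⟨4,4,4⟩`, `⟨3,·,3⟩` blocks in `F₂ⁿ (n ≤ 8)`, `F₃⁴`, `(ℤ/4)³`, and cyclic groups for contrast —
does any design beat the coherent bound `ρ ≤ 1/M`?  Results are appended below as they arrive. -/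

/-! ## NearMisses (sorries allowed only here) — currently none. -/

end Summit.MatrixMultiplication.MatrixMultiplication.Cruxes.BoundedExponentThird.Disproof
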